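import Summits.Schanuel.Schanuel.Theorems.DiophantineDichotomyApproximationPropertyDefs
import Summits.Schanuel.Schanuel.Theorems.DiophantineDichotomyApproximationPropertySharpClosestPointLemmas
import Summits.Schanuel.Schanuel.Theses.DiophantineDichotomy
import HarnessLib

/-!
# Stub `stub_sharpClosestPoint` of line `orbit-interpolation-determinant` (crux `ApproximationProperty`, stmt-Schanuel-6117)

The `ℓ`-extraction `OrbitClusterBound → ZeroDimDictionary → SharpClosestPoint` (the card's transfer
`C⁺`) of the checked skeleton `Cruxes/ApproximationProperty/Lines/orbit-interpolation-determinant.lean`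
(vocabulary: `DiophantineDichotomyApproximationPropertyDefs.lean`): given the lever
`OrbitClusterBound` (conjugate clustering costs `k^{1+1/m}`, paid in the interpolation degree) and
the 0-dimensional dictionary `ZeroDimDictionary` (structure of a homogeneous prime of rank `1` in
Nesterenko's elimination language), a homogeneous prime `𝔭 ⊂ ℚ[x₀, …, x_m]` of rank `1` whose zeros
impose independent conditions on the forms of degree `δ` has a zero `β̄` with
`‖(1:ω) − β̄‖^ℓ ≤ |𝔭(1:ω)| · exp(C δ h(𝔭)/ℓ^{1/m} + C' deg 𝔭 ((δ+1)(log(2+‖ω‖)+1) + log(deg 𝔭+1)))`,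
`C = 2 C_lever m/c₀` independent of `ℓ`, `ℓ ≥ ℓ₀ = ⌈(2/c₀)^m⌉ + 1`.

Proof: order the conjugates `σ ∘ b` of the dictionary's point by projective distance to
`ω̄ = (1 : ω)`; the `k` closest ones are affine-near `ω` (`PhilipponMain.affine_near_of_projDist_le`),
so the lever bounds `log (1/ρ_k) ≤ A + B k^{-1-1/m}` (`sharp_log_inv_projDist_le`); the extraction
`sharp_pow_le_prod_mul_exp` (tail sum `Σ_{k>ℓ} k^{-1-1/m} ≤ m ℓ^{-1/m}`) and the dictionary's value clause
`∏_σ ρ_σ ≤ e^{c deg 𝔭} |𝔭(ω̄)|` give the claim with the closest conjugate as witness; the real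
analysis is in `DiophantineDichotomyApproximationPropertySharpClosestPointLemmas.lean`.

Sources: NesterenkoPhilippon2001 (LNM 1752) Ch. 3 §4 (Prop. 4.13, the average form); the line's
idea card `Cruxes/ApproximationProperty/Ideas/orbit-interpolation-determinant.md`.
-/

noncomputable section

-- `Summit.Schanuel.Schanuel.…` is the mandated summit/sub-problem namespace (single-conjunct summit), hence:
set_option linter.dupNamespace false

attribute [local instance] MvPolynomial.gradedAlgebra

namespace Summit.Schanuel.Schanuel.Cruxes.ApproximationProperty.OrbitInterpolationDeterminant

open Literature.NumberTheory.Transcendental.Nesterenko MvPolynomial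
open Literature.NumberTheory.Transcendental.PhilipponMain
open scoped BigOperators

/-! ### The per-conjugate bound from the lever -/

/-- **The lever, applied to the `i + 1` closest conjugates.** Order the conjugates `τ 0, τ 1, …` of
the point `b` by projective distance `ρ` to `ω̄ = (1 : ω)`. If `i ≥ ℓ ≥ ⌈(2/c₀)^m⌉ + 1` and
`ρ (τ i) > 0`, then either `ρ (τ i) ≥ 1/(2|ω̄|²)`, or the `i + 1` closest conjugates are affine points
in the polydisc of radius `r = 2|ω̄|² ρ(τ i) ≤ 1` about `ω` (`affine_near_of_projDist_le`) and the
orbit-cluster bound with `k = i + 1` distinct embeddings gives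
`log (1/ρ(τ i)) ≤ log (2|ω̄|²) + (2C/c₀)(δ log(2+‖ω‖) + log(δ+2)) + (2C/c₀)(δ (h + c D) + D log(D+1)) (i+1)^{-1-1/m}`.
[folklore] -/
theorem sharp_log_inv_projDist_le {m : ℕ} (hm : 1 ≤ m) {c₀ C cd : ℝ} (hc₀ : 0 < c₀) (hC : 0 < C)
    {K : Type} [Field K] [NumberField K]
    (hocb : ∀ (β : Fin m → K) (δ k : ℕ) (σ : Fin k → (K →+* ℂ)) (x : Fin m → ℂ) (r : ℝ),
      (∀ z : K, ∃ Q : MvPolynomial (Fin m) ℚ, Q.totalDegree ≤ δ ∧ MvPolynomial.aeval β Q = z) →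
      Function.Injective σ → 0 < r → r ≤ 1 →
      (∀ i, ‖(fun j => σ i (β j)) - x‖ ≤ r) →
      (c₀ * (k : ℝ) ^ (1 + 1 / (m : ℝ)) - k) * Real.log (1 / r) ≤
        C * (δ * Height.logHeight (Fin.cons (1 : K) β : Fin (m + 1) → K) +
          Module.finrank ℚ K * Real.log (Module.finrank ℚ K + 1) +
          k * δ * Real.log (2 + ‖x‖) + k * Real.log ((δ : ℝ) + 2)))
    {b : Fin (m + 1) → K} (hb0 : b ≠ 0) {δ : ℕ}
    (hE : b 0 ≠ 0 → ∀ z : K, ∃ Q : MvPolynomial (Fin m) ℚ, Q.totalDegree ≤ δ ∧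
      MvPolynomial.aeval (fun j : Fin m => b j.succ / b 0) Q = z)
    {D : ℕ} (hB : Module.finrank ℚ K = D) {hgt : ℝ} (hCht : Height.logHeight b ≤ hgt + cd * D)
    (ω : Fin m → ℂ) {τ : Fin D → (K →+* ℂ)} (hτ : Function.Injective τ)
    (hmono : Monotone fun i => projDist (Fin.cons 1 ω) (fun j => τ i (b j)))
    {ℓ : ℕ} (hℓ : ⌈(2 / c₀) ^ m⌉₊ + 1 ≤ ℓ) (i : Fin D) (hi : ℓ ≤ (i : ℕ))
    (hpos : 0 < projDist (Fin.cons 1 ω) (fun j => τ i (b j))) :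
    Real.log (1 / projDist (Fin.cons 1 ω) (fun j => τ i (b j))) ≤
      Real.log (2 * ‖(Fin.cons 1 ω : Fin (m + 1) → ℂ)‖ ^ 2) +
          2 * C / c₀ * (δ * Real.log (2 + ‖ω‖) + Real.log ((δ : ℝ) + 2)) +
        2 * C / c₀ * (δ * (hgt + cd * D) + D * Real.log ((D : ℝ) + 1)) *
          ((i : ℝ) + 1) ^ (-(1 + 1 / (m : ℝ))) := by
  have hm0 : (0 : ℝ) < m := by exact_mod_cast hm
  set ωb : Fin (m + 1) → ℂ := Fin.cons 1 ω with hωb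
  set Θ : ℝ := ‖ωb‖ with hΘ
  have hΘ1 : 1 ≤ Θ := one_le_norm_cons_one ω
  set L : ℝ := Real.log (2 + ‖ω‖) with hL
  set LD : ℝ := Real.log ((D : ℝ) + 1) with hLD
  set κ : ℝ := 2 * C / c₀ with hκ
  have hL0 : 0 < L := (Real.log_pos one_lt_two).trans_le
    (Real.log_le_log two_pos (by linarith [norm_nonneg ω]))
  have hD1 : (1 : ℝ) ≤ D := by
    have : 0 < D := by rw [← hB]; exact Module.finrank_pos
    exact_mod_cast this
  have hLD0 : 0 ≤ LD := Real.log_nonneg (by linarith)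
  have hκ0 : 0 < κ := by positivity
  have hlogδ : 0 ≤ Real.log ((δ : ℝ) + 2) :=
    Real.log_nonneg (by linarith [(Nat.cast_nonneg δ : (0 : ℝ) ≤ δ)])
  have hhgt : 0 ≤ hgt + cd * D := (Height.logHeight_nonneg b).trans hCht
  set ρ : (K →+* ℂ) → ℝ := fun σ => projDist ωb (fun j => σ (b j)) with hρ
  have hρ0 : ∀ σ, 0 ≤ ρ σ := fun σ => projDist_nonneg _ _
  set ρi : ℝ := ρ (τ i) with hρi
  -- `k = i + 1`, `P = k^{1+1/m}`
  set k : ℕ := (i : ℕ) + 1 with hk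
  have hkD : k ≤ D := i.2
  have hkr : (k : ℝ) = (i : ℝ) + 1 := by rw [hk]; push_cast; ring
  have hkpos : (0 : ℝ) < k := by rw [hkr]; positivity
  have hk1 : (1 : ℝ) ≤ k := by rw [hkr]; linarith [(Nat.cast_nonneg (i : ℕ) : (0 : ℝ) ≤ i)]
  have hPdef : ((i : ℝ) + 1) ^ (-(1 + 1 / (m : ℝ))) = ((k : ℝ) ^ (1 + 1 / (m : ℝ)))⁻¹ := by
    rw [← hkr, Real.rpow_neg hkpos.le]
  set P : ℝ := (k : ℝ) ^ (1 + 1 / (m : ℝ)) with hP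
  have hP0 : 0 < P := Real.rpow_pos_of_pos hkpos _
  have hkP : (k : ℝ) ≤ P := by
    rw [hP, Real.rpow_add hkpos, Real.rpow_one]
    exact le_mul_of_one_le_right hkpos.le (Real.one_le_rpow hk1 (by positivity))
  have hBi0 : 0 ≤ κ * (δ * (hgt + cd * D) + D * LD) * ((i : ℝ) + 1) ^ (-(1 + 1 / (m : ℝ))) :=
    mul_nonneg (by positivity) (Real.rpow_nonneg (by positivity) _)
  have hAi0 : 0 ≤ κ * (δ * L + Real.log ((δ : ℝ) + 2)) := by positivity
  by_cases hsmall : ρi * (2 * Θ ^ 2) ≤ 1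
  swap
  · -- a far conjugate costs `log (2Θ²)` only
    have hlt : 1 < ρi * (2 * Θ ^ 2) := lt_of_not_ge hsmall
    have : Real.log (1 / ρi) ≤ Real.log (2 * Θ ^ 2) := by
      refine Real.log_le_log (by positivity) ?_
      rw [div_le_iff₀ hpos]; linarith
    linarith
  -- a near conjugate: the `k = i + 1` closest conjugates are affine points near `ω`
  set r : ℝ := 2 * Θ ^ 2 * ρi with hr
  have hr0 : 0 < r := by positivity
  have hr1 : r ≤ 1 := by rw [hr]; linarith
  set σ' : Fin k → (K →+* ℂ) := fun j => τ (Fin.castLE hkD j) with hσ'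
  have hσ'inj : Function.Injective σ' := hτ.comp (Fin.castLE_injective hkD)
  have hσ'le : ∀ j : Fin k, ρ (σ' j) ≤ ρi := fun j => by
    have hji : Fin.castLE hkD j ≤ i := by
      rw [Fin.le_def, Fin.val_castLE]; omega
    exact hmono hji
  have hnear' : ∀ j : Fin k, σ' j (b 0) ≠ 0 ∧
      ∀ j' : Fin m, ‖σ' j (b j'.succ) / σ' j (b 0) - ω j'‖ ≤ r := by
    intro j
    have hd : projDist ωb (fun j' => σ' j (b j')) * ‖ωb‖ ≤ 1 / 2 := by
      have h1 : projDist ωb (fun j' => σ' j (b j')) ≤ ρi := hσ'le j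
      have h2 : ρi * Θ ≤ 1 / 2 := by
        have : ρi * Θ ≤ ρi * Θ * Θ := le_mul_of_one_le_right (by positivity) hΘ1
        linarith
      calc _ ≤ ρi * Θ := mul_le_mul_of_nonneg_right h1 (by positivity)
        _ ≤ 1 / 2 := h2
    obtain ⟨h0, -, hz⟩ := affine_near_of_projDist_le ω (sharp_conj_ne_zero (σ' j) hb0) hd
    refine ⟨h0, fun j' => (hz j').trans ?_⟩
    exact mul_le_mul_of_nonneg_left (hσ'le j) (by positivity)
  have hb00 : b 0 ≠ 0 := by
    intro h
    exact (hnear' ⟨0, by omega⟩).1 (by rw [h, map_zero])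
  set b' : Fin m → K := fun j' => b j'.succ / b 0 with hb'
  have hnear : ∀ j : Fin k, ‖(fun j' => σ' j (b' j')) - ω‖ ≤ r := by
    intro j
    refine (pi_norm_le_iff_of_nonneg hr0.le).mpr fun j' => ?_
    simp only [Pi.sub_apply, hb', map_div₀]
    exact (hnear' j).2 j'
  -- the lever
  have hlev := hocb b' δ k σ' ω r (hE hb00) hσ'inj hr0 hr1 hnear
  have hheight : Height.logHeight (Fin.cons (1 : K) b' : Fin (m + 1) → K) =
      Height.logHeight b := by
    have e : (Fin.cons (1 : K) b' : Fin (m + 1) → K) = (b 0)⁻¹ • b := by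
      funext j
      refine Fin.cases ?_ (fun j' => ?_) j
      · simp [hb00]
      · simp [hb', div_eq_inv_mul]
    rw [e, Height.logHeight_smul_eq_logHeight b (inv_ne_zero hb00)]
  rw [hheight, hB] at hlev
  -- the coefficient: `c₀ k^{1+1/m} − k ≥ (c₀/2) k^{1+1/m}` since `k ≥ ℓ₀`
  have hcoef : c₀ / 2 * P ≤ c₀ * P - k := by
    have hki : ⌈(2 / c₀) ^ m⌉₊ ≤ k := by omega
    have hk_ge : (2 / c₀) ^ m ≤ (k : ℝ) := (Nat.le_ceil _).trans (by exact_mod_cast hki)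
    have hkm : 2 / c₀ ≤ (k : ℝ) ^ (1 / (m : ℝ)) := by
      have := Real.rpow_le_rpow (by positivity) hk_ge (show (0 : ℝ) ≤ 1 / (m : ℝ) by positivity)
      rwa [show ((2 / c₀) ^ m) ^ (1 / (m : ℝ)) = 2 / c₀ from by
        rw [one_div]; exact Real.pow_rpow_inv_natCast (by positivity) (by omega)] at this
    have h3 : 1 ≤ c₀ / 2 * (k : ℝ) ^ (1 / (m : ℝ)) := by
      have := mul_le_mul_of_nonneg_left hkm (show 0 ≤ c₀ / 2 by positivity)
      rwa [show c₀ / 2 * (2 / c₀) = 1 by field_simp] at this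
    have h4 : (k : ℝ) ≤ c₀ / 2 * P := by
      rw [hP, Real.rpow_add hkpos, Real.rpow_one]
      calc (k : ℝ) = k * 1 := (mul_one _).symm
        _ ≤ k * (c₀ / 2 * (k : ℝ) ^ (1 / (m : ℝ))) := mul_le_mul_of_nonneg_left h3 hkpos.le
        _ = _ := by ring
    linarith
  have hlog_r : 0 ≤ Real.log (1 / r) :=
    Real.log_nonneg (by rw [le_div_iff₀ hr0]; linarith)
  have hmain : c₀ / 2 * P * Real.log (1 / r) ≤
      C * (δ * Height.logHeight b + D * LD + k * δ * L + k * Real.log ((δ : ℝ) + 2)) :=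
    (mul_le_mul_of_nonneg_right hcoef hlog_r).trans hlev
  have hc₀' : c₀ ≠ 0 := hc₀.ne'
  have hP' : P ≠ 0 := hP0.ne'
  have hT : C * (δ * Height.logHeight b + D * LD + k * δ * L + k * Real.log ((δ : ℝ) + 2)) ≤
      c₀ / 2 * P * (κ * (δ * L + Real.log ((δ : ℝ) + 2)) +
        κ * (δ * (hgt + cd * D) + D * LD) * P⁻¹) := by
    have e : c₀ / 2 * P * (κ * (δ * L + Real.log ((δ : ℝ) + 2)) +
        κ * (δ * (hgt + cd * D) + D * LD) * P⁻¹)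
        = C * P * (δ * L + Real.log ((δ : ℝ) + 2)) + C * (δ * (hgt + cd * D) + D * LD) := by
      rw [hκ]; field_simp
    rw [e]
    have hAL : 0 ≤ δ * L + Real.log ((δ : ℝ) + 2) := by positivity
    have h1 := mul_le_mul_of_nonneg_left (mul_le_mul_of_nonneg_right hkP hAL) hC.le
    have h2 := mul_le_mul_of_nonneg_left (mul_le_mul_of_nonneg_left hCht (Nat.cast_nonneg δ)) hC.le
    linarith
  have hlr : Real.log (1 / r) ≤ κ * (δ * L + Real.log ((δ : ℝ) + 2)) +
      κ * (δ * (hgt + cd * D) + D * LD) * P⁻¹ :=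
    le_of_mul_le_mul_left (hmain.trans hT) (by positivity)
  have hsplit : Real.log (1 / ρi) = Real.log (2 * Θ ^ 2) + Real.log (1 / r) := by
    rw [← Real.log_mul (by positivity) (by positivity)]
    congr 1
    rw [hr]; field_simp
  rw [hsplit, hPdef]
  linarith [hlr]

/-! ### The stub -/

/-- **Stub 4 of line `orbit-interpolation-determinant`** — the `ℓ`-extraction
`OrbitClusterBound → ZeroDimDictionary → SharpClosestPoint`: the lever (conjugate clustering costs
`k^{1+1/m}` in the interpolation degree) and the 0-dimensional dictionary give the sharp closest-point
property with the `ℓ`-independent constant `C = 2 C_lever m / c₀`, `ℓ₀ = ⌈(2/c₀)^m⌉ + 1` and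
`C'(ℓ) = ℓ log 2 + c + 3 + (2 C_lever/c₀)(1 + m c + m)`. [folklore] -/
theorem stub_sharpClosestPoint : OrbitClusterBound → ZeroDimDictionary → SharpClosestPoint := by
  intro hOCB hZDD m hm
  obtain ⟨c₀, hc₀, C, hC, hocb⟩ := hOCB m hm
  obtain ⟨cd, hcd, hdict⟩ := hZDD m hm
  have hlog2 : 0 < Real.log 2 := Real.log_pos one_lt_two
  have hm0 : (0 : ℝ) < m := by exact_mod_cast hm
  refine ⟨2 * C * m / c₀, by positivity, ⌈(2 / c₀) ^ m⌉₊ + 1, fun ℓ hℓ => ?_⟩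
  refine ⟨ℓ * Real.log 2 + cd + 3 + 2 * C / c₀ * (1 + m * cd + m), by positivity, ?_⟩
  intro 𝔭 δ ω h𝔭 hhom hunm hinterp
  obtain ⟨K, _i1, _i2, b, hb0, hA, -, hB, hCht, hDval, hE⟩ := hdict 𝔭 h𝔭 hhom hunm
  generalize hDdef : ideg 𝔭 1 = D at *
  -- basic quantities
  have hℓ1 : 1 ≤ ℓ := le_trans (Nat.le_add_left 1 _) hℓ
  have hD0 : 0 < D := by rw [← hB]; exact Module.finrank_pos
  have hD1r : (1 : ℝ) ≤ D := by exact_mod_cast hD0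
  have hcard : Fintype.card (K →+* ℂ) = D := by rw [NumberField.Embeddings.card, hB]
  set ωb : Fin (m + 1) → ℂ := Fin.cons 1 ω with hωb
  set Θ : ℝ := ‖ωb‖ with hΘ
  have hΘ1 : 1 ≤ Θ := one_le_norm_cons_one ω
  have hΘle : Θ ≤ 2 + ‖ω‖ := sharp_norm_cons_one_le ω
  set L : ℝ := Real.log (2 + ‖ω‖) with hL
  set hgt : ℝ := iheight 𝔭 1 with hhgt
  set LD : ℝ := Real.log ((D : ℝ) + 1) with hLD
  have hhgt0 : 0 ≤ hgt := height_nonneg _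
  have hL2 : Real.log 2 ≤ L := Real.log_le_log two_pos (by linarith [norm_nonneg ω])
  have hL0 : 0 < L := hlog2.trans_le hL2
  have hLD0 : 0 ≤ LD := Real.log_nonneg (by linarith)
  have hlogΘ2 : 0 ≤ Real.log (2 * Θ ^ 2) := Real.log_nonneg (by nlinarith)
  have hlogδ : 0 ≤ Real.log ((δ : ℝ) + 2) :=
    Real.log_nonneg (by linarith [(Nat.cast_nonneg δ : (0 : ℝ) ≤ δ)])
  -- the projective distances of the conjugates, sorted increasingly
  set ρ : (K →+* ℂ) → ℝ := fun σ => projDist ωb (fun j => σ (b j)) with hρ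
  have hρ0 : ∀ σ, 0 ≤ ρ σ := fun σ => projDist_nonneg _ _
  have hρ2 : ∀ σ, ρ σ ≤ 2 := fun σ =>
    Literature.NumberTheory.Transcendental.NguyenRoy.projDist_le_two _ _
  set e₀ : (K →+* ℂ) ≃ Fin D := Fintype.equivFinOfCardEq hcard
  set τ : Fin D ≃ (K →+* ℂ) := (Tuple.sort (ρ ∘ e₀.symm)).trans e₀.symm with hτ
  have hmono : Monotone (ρ ∘ τ) := Tuple.monotone_sort (ρ ∘ e₀.symm)
  -- the witness: the closest conjugate
  refine ⟨fun j => τ ⟨0, hD0⟩ (b j), ?_, ?_⟩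
  · rw [hA]
    exact ⟨sharp_conj_ne_zero _ hb0, τ ⟨0, hD0⟩, 1, by simp⟩
  -- constants of the per-conjugate bound
  set A : ℝ := Real.log (2 * Θ ^ 2) + 2 * C / c₀ * (δ * L + Real.log ((δ : ℝ) + 2)) with hAdef
  set B : ℝ := 2 * C / c₀ * (δ * (hgt + cd * D) + D * LD) with hBdef
  have hA0 : 0 ≤ A := by positivity
  have hB0 : 0 ≤ B := by positivity
  have hbound : ∀ i : Fin D, ℓ ≤ (i : ℕ) → 0 < (ρ ∘ τ) i →
      Real.log (1 / (ρ ∘ τ) i) ≤ A + B * ((i : ℝ) + 1) ^ (-(1 + 1 / (m : ℝ))) :=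
    fun i hi hpos => sharp_log_inv_projDist_le hm hc₀ hC (hocb K) hb0
      (fun h0 => hE h0 δ hinterp) hB hCht ω τ.injective hmono hℓ i hi hpos
  -- extraction
  have hext := sharp_pow_le_prod_mul_exp hm hℓ1 hD0 (ρ ∘ τ) hmono (fun i => hρ0 _) (fun i => hρ2 _)
    hA0 hB0 hbound
  set X : ℝ := ℓ * Real.log 2 + D * A + B * (m / (ℓ : ℝ) ^ (1 / (m : ℝ))) with hX
  have hprodτ : ∏ i, (ρ ∘ τ) i = ∏ σ, ρ σ := Equiv.prod_comp τ ρ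
  -- the dictionary's value clause
  have hval := hDval ωb (cons_one_ne_zero ω)
  have hprod_le : ∏ σ, ρ σ ≤ Real.exp (cd * D) * iabs 𝔭 1 ωb := by
    have := mul_le_mul_of_nonneg_left hval (Real.exp_nonneg (cd * D))
    rwa [← mul_assoc, ← Real.exp_add, add_neg_cancel, Real.exp_zero, one_mul] at this
  -- the final exponent
  have hfin : cd * D + X ≤ 2 * C * m / c₀ * δ * hgt / (ℓ : ℝ) ^ (1 / (m : ℝ)) +
      (ℓ * Real.log 2 + cd + 3 + 2 * C / c₀ * (1 + m * cd + m)) * D *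
        ((δ + 1) * (L + 1) + LD) := by
    rw [hX, hAdef, hBdef]
    have hν : (1 : ℝ) ≤ (ℓ : ℝ) ^ (1 / (m : ℝ)) :=
      Real.one_le_rpow (by exact_mod_cast hℓ1) (by positivity)
    have hlogΘ : Real.log Θ ≤ L := Real.log_le_log (by linarith) hΘle
    have key := sharp_exponent_le (h := hgt) hC hc₀ hcd (show (1 : ℝ) ≤ m by exact_mod_cast hm)
      (Nat.cast_nonneg δ) hD1r hL2 hΘ1 hlogΘ (show (1 : ℝ) ≤ ℓ by exact_mod_cast hℓ1)
      hν hLD0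
    linarith [key]
  calc projDist ωb (fun j => τ ⟨0, hD0⟩ (b j)) ^ ℓ
      ≤ (∏ i, (ρ ∘ τ) i) * Real.exp X := hext
    _ = (∏ σ, ρ σ) * Real.exp X := by rw [hprodτ]
    _ ≤ Real.exp (cd * D) * iabs 𝔭 1 ωb * Real.exp X :=
        mul_le_mul_of_nonneg_right hprod_le (Real.exp_nonneg _)
    _ = iabs 𝔭 1 ωb * Real.exp (cd * D + X) := by rw [Real.exp_add (cd * D) X]; ring
    _ ≤ _ := mul_le_mul_of_nonneg_left (Real.exp_le_exp.mpr hfin) (iabs_nonneg _ _ _)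

end Summit.Schanuel.Schanuel.Cruxes.ApproximationProperty.OrbitInterpolationDeterminant

end
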